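import Summits.AnomalousDissipation.AnomalousDissipation.Theorems.SawtoothPulseCascadeK1LocalisedCascadeKHSourceResponse
import Summits.AnomalousDissipation.AnomalousDissipation.Theorems.SawtoothPulseCascadeK1LocalisedCascadeKHCreationAtoms

/-!
# K2 lane (route-2 `SawtoothPulseCascade`, crux dir `K1LocalisedCascade`): the COMB-COLUMN source — pointwise Lorentzian envelope of the mode-`0` source

Helper file of the K2 lane (ACL item stmt-AnomalousDissipation-19491; E5 tail of the S4 line, arbiter A26-12/A26-13 «P2-T»). For the interior
mode `ξ = 0` (the comb column: `K2ConeSketch` §6.4 `combState`, `vFresh … (singleMode 0)`), every one of the six closed-form terms of the source on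
a kink line (`src_quarter_pieces`, `src_negQuarter_pieces` of `…KHSourceResponse`, any Bloch phase `β`, `a > 0`) has a Lorentz denominator
`±κ + i(±κ)s`, `κ = 2πa`, of modulus EXACTLY `κ√(1+s²)`; hence the source obeys the POINTWISE envelope
`‖src(±¼, s)‖ ≤ N(a) / ((1−q)·2κ·κ√(1+s²))`, `N(a) = 2 + 2x + 4x² + 2x³ + 2x⁴`, `x = e^{−κ/4}`, `q = e^{−κ}` (`norm_src_quarter_mode0_le`,
`norm_src_negQuarter_mode0_le`): one coherent `1/√(1+s²)` corner pulse of height `≈ 1/κ²` (the two near-field halves `x⁰` add up to the `2`) plus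
exponentially small images. This is the input of the comb-column creation law (`…KHCombDuhamel`). No definitions; no statement about the crux.
[cite: Drazin2002, §8.3 (8.36)–(8.38)] [problem: turb]
-/

-- `Summit.<Summit>.<Problem>`: single-conjunct summit, the duplicate namespace segment is deliberate.
set_option linter.dupNamespace false

noncomputable section

namespace Summit.AnomalousDissipation.AnomalousDissipation.Theorems.SawtoothPulseCascade.K2PhaseBudget

open Set MeasureTheory intervalIntegral Literature.Analysis.FluidPDE.SawtoothCascade

/-! ## §1 Atoms: one Lorentzian term at mode `0` -/

/-- The Lorentz denominator at mode `0`: `‖±κ + i(±κ)s‖ = κ√(1+s²)` (`κ = 2πa > 0`). [folklore] -/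
theorem norm_lorentz_denom_mode0 {a μ ν ν₀ : ℝ} (ha : 0 < a) (hμ : μ = 2 * Real.pi * a ∨ μ = -(2 * Real.pi * a))
    (hν : ν = 2 * Real.pi * a ∨ ν = -(2 * Real.pi * a)) (hν₀ : ν₀ = 0) (s : ℝ) :
    ‖(μ : ℂ) + ((ν₀ + ν * s : ℝ) : ℂ) * Complex.I‖ = (2 * Real.pi * a) * Real.sqrt (1 + s ^ 2) := by
  have hκ : 0 < 2 * Real.pi * a := by positivity
  have hμ2 : μ ^ 2 = (2 * Real.pi * a) ^ 2 := by rcases hμ with h | h <;> rw [h]; ring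
  have hν2 : ν ^ 2 = (2 * Real.pi * a) ^ 2 := by rcases hν with h | h <;> rw [h]; ring
  rw [Complex.norm_def, normSq_lorentz_denom, hν₀, zero_add, mul_pow, hμ2, hν2,
    show (2 * Real.pi * a) ^ 2 + (2 * Real.pi * a) ^ 2 * s ^ 2 = (2 * Real.pi * a) ^ 2 * (1 + s ^ 2) by ring,
    Real.sqrt_mul' _ (by positivity), Real.sqrt_sq hκ.le]

/-- `‖e^{λy}‖ = e^{μy}` for `λ = μ + it`, `y` real. [folklore] -/
theorem norm_cexp_lorentz_mul (μ t y : ℝ) :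
    ‖Complex.exp (((μ : ℂ) + (t : ℂ) * Complex.I) * (y : ℂ))‖ = Real.exp (μ * y) := by
  rw [Complex.norm_exp]
  congr 1
  simp

/-- **One term:** `‖(e^{λy₂} − e^{λy₁})/λ‖ ≤ (e^{μy₂} + e^{μy₁})/(κ√(1+s²))` for `λ = ±κ + i(±κ)s`. [folklore] -/
theorem norm_twoExp_div_mode0_le {a μ ν ν₀ : ℝ} (ha : 0 < a) (hμ : μ = 2 * Real.pi * a ∨ μ = -(2 * Real.pi * a))
    (hν : ν = 2 * Real.pi * a ∨ ν = -(2 * Real.pi * a)) (hν₀ : ν₀ = 0) (y₁ y₂ s : ℝ) :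
    ‖(Complex.exp (((μ : ℂ) + ((ν₀ + ν * s : ℝ) : ℂ) * Complex.I) * (y₂ : ℂ)) -
        Complex.exp (((μ : ℂ) + ((ν₀ + ν * s : ℝ) : ℂ) * Complex.I) * (y₁ : ℂ))) /
        ((μ : ℂ) + ((ν₀ + ν * s : ℝ) : ℂ) * Complex.I)‖ ≤
      (Real.exp (μ * y₂) + Real.exp (μ * y₁)) / ((2 * Real.pi * a) * Real.sqrt (1 + s ^ 2)) := by
  rw [norm_div, norm_lorentz_denom_mode0 ha hμ hν hν₀ s]
  apply div_le_div_of_nonneg_right _ (by positivity)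
  exact (norm_sub_le _ _).trans (by rw [norm_cexp_lorentz_mul, norm_cexp_lorentz_mul])

/-- **An `A`-type term** (kernel branch `e^{−κr}`): `‖P·A·e^{−κm}·(e^{λy₂}−e^{λy₁})/λ‖ ≤ e^{−κm}(e^{μy₂}+e^{μy₁})/((1−q)2κ·κ√(1+s²))`
(`‖P‖ = 1`, `‖A‖ ≤ 1/((1−q)2κ)` by `norm_coefA_le`). [cite: Drazin2002, §8.3 (8.36)–(8.38)] -/
theorem norm_termA_mode0_le {a μ ν ν₀ : ℝ} (ha : 0 < a) (β : ℝ) {P : ℂ} (hP : ‖P‖ = 1)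
    (hμ : μ = 2 * Real.pi * a ∨ μ = -(2 * Real.pi * a)) (hν : ν = 2 * Real.pi * a ∨ ν = -(2 * Real.pi * a)) (hν₀ : ν₀ = 0)
    {mc : ℂ} (m y₁ y₂ s : ℝ) (hm : mc = (m : ℂ)) :
    ‖(P * (-1 / ((1 - starRingEnd ℂ (Complex.exp (2 * Real.pi * β * Complex.I)) * (Real.exp (-(2 * Real.pi * a)) : ℂ)) * (2 * (2 * Real.pi * a)))) *
        Complex.exp (-((2 * Real.pi * a : ℝ) : ℂ) * mc)) *
      ((Complex.exp (((μ : ℂ) + ((ν₀ + ν * s : ℝ) : ℂ) * Complex.I) * (y₂ : ℂ)) -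
        Complex.exp (((μ : ℂ) + ((ν₀ + ν * s : ℝ) : ℂ) * Complex.I) * (y₁ : ℂ))) /
        ((μ : ℂ) + ((ν₀ + ν * s : ℝ) : ℂ) * Complex.I))‖ ≤
      Real.exp (-(2 * Real.pi * a) * m) * (Real.exp (μ * y₂) + Real.exp (μ * y₁)) /
        (((1 - Real.exp (-(2 * Real.pi * a))) * (2 * (2 * Real.pi * a))) * ((2 * Real.pi * a) * Real.sqrt (1 + s ^ 2))) := by
  subst hm
  have hA := norm_coefA_le ha β
  have hT := norm_twoExp_div_mode0_le ha hμ hν hν₀ y₁ y₂ s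
  have hq1 : Real.exp (-(2 * Real.pi * a)) < 1 := Real.exp_lt_one_iff.2 (by nlinarith [Real.pi_pos])
  have hκ : 0 < 2 * (2 * Real.pi * a) := by positivity
  have hden : 0 < (1 - Real.exp (-(2 * Real.pi * a))) * (2 * (2 * Real.pi * a)) := by nlinarith
  have hE : ‖Complex.exp (-((2 * Real.pi * a : ℝ) : ℂ) * (m : ℂ))‖ = Real.exp (-(2 * Real.pi * a) * m) := by
    rw [show -((2 * Real.pi * a : ℝ) : ℂ) * (m : ℂ) = ((-(2 * Real.pi * a) * m : ℝ) : ℂ) by push_cast; ring, ← Complex.ofReal_exp,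
      Complex.norm_real, Real.norm_eq_abs, abs_of_pos (Real.exp_pos _)]
  rw [norm_mul, norm_mul, norm_mul, hP, one_mul, hE]
  calc ‖(-1 / ((1 - starRingEnd ℂ (Complex.exp (2 * Real.pi * β * Complex.I)) * (Real.exp (-(2 * Real.pi * a)) : ℂ)) * (2 * (2 * Real.pi * a))) : ℂ)‖ *
          Real.exp (-(2 * Real.pi * a) * m) *
        ‖(Complex.exp (((μ : ℂ) + ((ν₀ + ν * s : ℝ) : ℂ) * Complex.I) * (y₂ : ℂ)) -
            Complex.exp (((μ : ℂ) + ((ν₀ + ν * s : ℝ) : ℂ) * Complex.I) * (y₁ : ℂ))) /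
            ((μ : ℂ) + ((ν₀ + ν * s : ℝ) : ℂ) * Complex.I)‖
        ≤ 1 / ((1 - Real.exp (-(2 * Real.pi * a))) * (2 * (2 * Real.pi * a))) * Real.exp (-(2 * Real.pi * a) * m) *
          ((Real.exp (μ * y₂) + Real.exp (μ * y₁)) / ((2 * Real.pi * a) * Real.sqrt (1 + s ^ 2))) := by
        gcongr
    _ = _ := by field_simp

/-- **A `B`-type term** (kernel branch `e^{κ(r−1)}`): `‖P·B·e^{κm}·(e^{λy₂}−e^{λy₁})/λ‖ ≤ q·e^{κm}(e^{μy₂}+e^{μy₁})/((1−q)2κ·κ√(1+s²))`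
(`‖P‖ = 1`, `‖B‖ ≤ q/((1−q)2κ)` by `norm_coefB_le`). [cite: Drazin2002, §8.3 (8.36)–(8.38)] -/
theorem norm_termB_mode0_le {a μ ν ν₀ : ℝ} (ha : 0 < a) (β : ℝ) {P : ℂ} (hP : ‖P‖ = 1)
    (hμ : μ = 2 * Real.pi * a ∨ μ = -(2 * Real.pi * a)) (hν : ν = 2 * Real.pi * a ∨ ν = -(2 * Real.pi * a)) (hν₀ : ν₀ = 0)
    {mc : ℂ} (m y₁ y₂ s : ℝ) (hm : mc = (m : ℂ)) :
    ‖(P * (-(Complex.exp (2 * Real.pi * β * Complex.I) * (Real.exp (-(2 * Real.pi * a)) : ℂ)) /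
        ((1 - Complex.exp (2 * Real.pi * β * Complex.I) * (Real.exp (-(2 * Real.pi * a)) : ℂ)) * (2 * (2 * Real.pi * a)))) *
        Complex.exp (((2 * Real.pi * a : ℝ) : ℂ) * mc)) *
      ((Complex.exp (((μ : ℂ) + ((ν₀ + ν * s : ℝ) : ℂ) * Complex.I) * (y₂ : ℂ)) -
        Complex.exp (((μ : ℂ) + ((ν₀ + ν * s : ℝ) : ℂ) * Complex.I) * (y₁ : ℂ))) /
        ((μ : ℂ) + ((ν₀ + ν * s : ℝ) : ℂ) * Complex.I))‖ ≤
      Real.exp (-(2 * Real.pi * a)) * Real.exp ((2 * Real.pi * a) * m) * (Real.exp (μ * y₂) + Real.exp (μ * y₁)) /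
        (((1 - Real.exp (-(2 * Real.pi * a))) * (2 * (2 * Real.pi * a))) * ((2 * Real.pi * a) * Real.sqrt (1 + s ^ 2))) := by
  subst hm
  have hB := norm_coefB_le ha β
  have hT := norm_twoExp_div_mode0_le ha hμ hν hν₀ y₁ y₂ s
  have hq1 : Real.exp (-(2 * Real.pi * a)) < 1 := Real.exp_lt_one_iff.2 (by nlinarith [Real.pi_pos])
  have hκ : 0 < 2 * (2 * Real.pi * a) := by positivity
  have hden : 0 < (1 - Real.exp (-(2 * Real.pi * a))) * (2 * (2 * Real.pi * a)) := by nlinarith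
  have hE : ‖Complex.exp (((2 * Real.pi * a : ℝ) : ℂ) * (m : ℂ))‖ = Real.exp ((2 * Real.pi * a) * m) := by
    rw [show ((2 * Real.pi * a : ℝ) : ℂ) * (m : ℂ) = (((2 * Real.pi * a) * m : ℝ) : ℂ) by push_cast; ring, ← Complex.ofReal_exp,
      Complex.norm_real, Real.norm_eq_abs, abs_of_pos (Real.exp_pos _)]
  rw [norm_mul, norm_mul, norm_mul, hP, one_mul, hE]
  calc ‖(-(Complex.exp (2 * Real.pi * β * Complex.I) * (Real.exp (-(2 * Real.pi * a)) : ℂ)) /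
          ((1 - Complex.exp (2 * Real.pi * β * Complex.I) * (Real.exp (-(2 * Real.pi * a)) : ℂ)) * (2 * (2 * Real.pi * a))) : ℂ)‖ *
          Real.exp ((2 * Real.pi * a) * m) *
        ‖(Complex.exp (((μ : ℂ) + ((ν₀ + ν * s : ℝ) : ℂ) * Complex.I) * (y₂ : ℂ)) -
            Complex.exp (((μ : ℂ) + ((ν₀ + ν * s : ℝ) : ℂ) * Complex.I) * (y₁ : ℂ))) /
            ((μ : ℂ) + ((ν₀ + ν * s : ℝ) : ℂ) * Complex.I)‖
        ≤ Real.exp (-(2 * Real.pi * a)) / ((1 - Real.exp (-(2 * Real.pi * a))) * (2 * (2 * Real.pi * a))) * Real.exp ((2 * Real.pi * a) * m) *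
          ((Real.exp (μ * y₂) + Real.exp (μ * y₁)) / ((2 * Real.pi * a) * Real.sqrt (1 + s ^ 2))) := by
        gcongr
    _ = _ := by field_simp

/-- Six-term triangle inequality behind the source envelope: three unit phases times two-term pieces. [folklore] -/
theorem norm_six_le {φ₁ φ₂ φ₃ s : ℝ} {A₁ B₁ A₂ B₂ A₃ B₃ : ℂ} {a₁ b₁ a₂ b₂ a₃ b₃ : ℝ}
    (h₁ : ‖A₁‖ ≤ a₁) (h₂ : ‖B₁‖ ≤ b₁) (h₃ : ‖A₂‖ ≤ a₂) (h₄ : ‖B₂‖ ≤ b₂) (h₅ : ‖A₃‖ ≤ a₃) (h₆ : ‖B₃‖ ≤ b₃) :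
    ‖Complex.exp (((φ₁ * s : ℝ) : ℂ) * Complex.I) * (A₁ + B₁) + Complex.exp (((φ₂ * s : ℝ) : ℂ) * Complex.I) * (A₂ + B₂) +
        Complex.exp (((φ₃ * s : ℝ) : ℂ) * Complex.I) * (A₃ + B₃)‖ ≤ a₁ + b₁ + a₂ + b₂ + a₃ + b₃ := by
  have hp : ∀ (φ : ℝ) (A B : ℂ) (x y : ℝ), ‖A‖ ≤ x → ‖B‖ ≤ y → ‖Complex.exp (((φ * s : ℝ) : ℂ) * Complex.I) * (A + B)‖ ≤ x + y := by
    intro φ A B x y hA hB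
    rw [norm_mul, Complex.norm_exp_ofReal_mul_I, one_mul]
    exact (norm_add_le _ _).trans (add_le_add hA hB)
  have e1 := hp φ₁ A₁ B₁ a₁ b₁ h₁ h₂
  have e2 := hp φ₂ A₂ B₂ a₂ b₂ h₃ h₄
  have e3 := hp φ₃ A₃ B₃ a₃ b₃ h₅ h₆
  have t := (norm_add_le _ _).trans (add_le_add ((norm_add_le _ _).trans (add_le_add e1 e2)) e3)
  linarith

/-! ## §2 The mode-`0` source envelopes -/

section envelope

variable {a : ℝ} {K G : ℝ → ℂ}

/-- **Mode-`0` source at `y₀ = ¼`, pointwise envelope** (`a > 0`, any Bloch phase `β`, any strain time `s`):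
`‖∫_{−½}^{½} G(¼−y) e^{−2πiasT(y)} dy‖ ≤ (2 + 2x + 4x² + 2x³ + 2x⁴)/((1−q)·2κ·κ√(1+s²))`, `x = e^{−κ/4}`, `q = e^{−κ}`, `κ = 2πa`.
[cite: Drazin2002, §8.3 (8.36)–(8.38)] -/
theorem norm_src_quarter_mode0_le (ha : 0 < a) (β s : ℝ)
    (hK : K = fun r : ℝ => (-((Real.exp (-(2 * Real.pi * a * r)) : ℂ) /
            (1 - starRingEnd ℂ (Complex.exp (2 * Real.pi * β * Complex.I)) * (Real.exp (-(2 * Real.pi * a)) : ℂ))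
          + (Real.exp (2 * Real.pi * a * (r - 1)) : ℂ) * Complex.exp (2 * Real.pi * β * Complex.I) /
            (1 - Complex.exp (2 * Real.pi * β * Complex.I) * (Real.exp (-(2 * Real.pi * a)) : ℂ))) /
        (2 * (2 * Real.pi * a) : ℂ)))
    (hG : ∀ u : ℝ, G u = Complex.exp (2 * Real.pi * β * (⌊u⌋ : ℝ) * Complex.I) * K (u - ⌊u⌋)) :
    ‖∫ y in (-(1 / 2 : ℝ))..(1 / 2 : ℝ), G ((1 / 4 : ℝ) - y) * Complex.exp (-((2 * Real.pi * a * s * triWave y : ℝ) : ℂ) * Complex.I)‖ ≤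
      (2 + 2 * Real.exp (-(2 * Real.pi * a) / 4) + 4 * Real.exp (-(2 * Real.pi * a) / 4) ^ 2 + 2 * Real.exp (-(2 * Real.pi * a) / 4) ^ 3 +
          2 * Real.exp (-(2 * Real.pi * a) / 4) ^ 4) /
        (((1 - Real.exp (-(2 * Real.pi * a))) * (2 * (2 * Real.pi * a))) * ((2 * Real.pi * a) * Real.sqrt (1 + s ^ 2))) := by
  have hI : (∫ y in (-(1 / 2 : ℝ))..(1 / 2 : ℝ), G ((1 / 4 : ℝ) - y) * Complex.exp (-((2 * Real.pi * a * s * triWave y : ℝ) : ℂ) * Complex.I)) =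
      ∫ y in (-(1 / 2 : ℝ))..(1 / 2 : ℝ), G ((1 / 4 : ℝ) - y) * Complex.exp (((2 * Real.pi * (0 : ℝ) * y : ℝ) : ℂ) * Complex.I) *
        Complex.exp (-((2 * Real.pi * a * s * triWave y : ℝ) : ℂ) * Complex.I) :=
    intervalIntegral.integral_congr fun y _ => by simp
  rw [hI, src_quarter_pieces ha β 0 hK hG s]
  refine (norm_six_le (φ₁ := Real.pi * a) (φ₂ := 0) (φ₃ := -(Real.pi * a)) (s := s)
    (norm_termA_mode0_le ha β (P := 1) (by simp) (Or.inl rfl) (Or.inl rfl) (ν₀ := 2 * Real.pi * 0) (by ring) (1 / 4) (-(1 / 2)) (-(1 / 4)) s (by simp))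
    (norm_termB_mode0_le ha β (P := 1) (by simp) (Or.inr rfl) (Or.inl rfl) (ν₀ := 2 * Real.pi * 0) (by ring) (1 / 4) (-(1 / 2)) (-(1 / 4)) s (by simp))
    (norm_termA_mode0_le ha β (P := 1) (by simp) (Or.inl rfl) (Or.inr rfl) (ν₀ := 2 * Real.pi * 0) (by ring) (1 / 4) (-(1 / 4)) (1 / 4) s (by simp))
    (norm_termB_mode0_le ha β (P := 1) (by simp) (Or.inr rfl) (Or.inr rfl) (ν₀ := 2 * Real.pi * 0) (by ring) (1 / 4) (-(1 / 4)) (1 / 4) s (by simp))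
    (norm_termA_mode0_le ha β (norm_pref_conj β) (Or.inl rfl) (Or.inl rfl) (ν₀ := 2 * Real.pi * 0) (by ring) (5 / 4) (1 / 4) (1 / 2) s (by simp))
    (norm_termB_mode0_le ha β (norm_pref_conj β) (Or.inr rfl) (Or.inl rfl) (ν₀ := 2 * Real.pi * 0) (by ring) (5 / 4) (1 / 4) (1 / 2) s (by simp))).trans
    (le_of_eq ?_)
  set x : ℝ := Real.exp (-(2 * Real.pi * a) / 4) with hx
  have hxj : ∀ (t : ℝ) (j : ℕ), t = -(2 * Real.pi * a) / 4 * j → Real.exp t = x ^ j := by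
    intro t j ht; rw [ht, hx, ← Real.exp_nat_mul]; ring_nf
  have p1 : Real.exp (-(2 * Real.pi * a) * (1 / 4)) * (Real.exp (2 * Real.pi * a * -(1 / 4)) + Real.exp (2 * Real.pi * a * -(1 / 2))) =
      x ^ 2 + x ^ 3 := by
    rw [mul_add, ← Real.exp_add, ← Real.exp_add, hxj _ 2 (by push_cast; ring), hxj _ 3 (by push_cast; ring)]
  have p2 : Real.exp (-(2 * Real.pi * a)) * Real.exp (2 * Real.pi * a * (1 / 4)) *
      (Real.exp (-(2 * Real.pi * a) * -(1 / 4)) + Real.exp (-(2 * Real.pi * a) * -(1 / 2))) = x ^ 2 + x := by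
    rw [mul_add, ← Real.exp_add, ← Real.exp_add, ← Real.exp_add, hxj _ 2 (by push_cast; ring), hxj _ 1 (by push_cast; ring), pow_one]
  have p3 : Real.exp (-(2 * Real.pi * a) * (1 / 4)) * (Real.exp (2 * Real.pi * a * (1 / 4)) + Real.exp (2 * Real.pi * a * -(1 / 4))) =
      1 + x ^ 2 := by
    rw [mul_add, ← Real.exp_add, ← Real.exp_add, hxj _ 0 (by push_cast; ring), hxj _ 2 (by push_cast; ring), pow_zero]
  have p4 : Real.exp (-(2 * Real.pi * a)) * Real.exp (2 * Real.pi * a * (1 / 4)) *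
      (Real.exp (-(2 * Real.pi * a) * (1 / 4)) + Real.exp (-(2 * Real.pi * a) * -(1 / 4))) = x ^ 4 + x ^ 2 := by
    rw [mul_add, ← Real.exp_add, ← Real.exp_add, ← Real.exp_add, hxj _ 4 (by push_cast; ring), hxj _ 2 (by push_cast; ring)]
  have p5 : Real.exp (-(2 * Real.pi * a) * (5 / 4)) * (Real.exp (2 * Real.pi * a * (1 / 2)) + Real.exp (2 * Real.pi * a * (1 / 4))) =
      x ^ 3 + x ^ 4 := by
    rw [mul_add, ← Real.exp_add, ← Real.exp_add, hxj _ 3 (by push_cast; ring), hxj _ 4 (by push_cast; ring)]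
  have p6 : Real.exp (-(2 * Real.pi * a)) * Real.exp (2 * Real.pi * a * (5 / 4)) *
      (Real.exp (-(2 * Real.pi * a) * (1 / 2)) + Real.exp (-(2 * Real.pi * a) * (1 / 4))) = x + 1 := by
    rw [mul_add, ← Real.exp_add, ← Real.exp_add, ← Real.exp_add, hxj _ 1 (by push_cast; ring), hxj _ 0 (by push_cast; ring), pow_one,
      pow_zero]
  rw [p1, p2, p3, p4, p5, p6]
  ring


/-- **Mode-`0` source at `y₀ = −¼`, pointwise envelope** (`a > 0`, any Bloch phase `β`, any strain time `s`):
`‖∫_{−½}^{½} G(−¼−y) e^{−2πiasT(y)} dy‖ ≤ (2 + 2x + 4x² + 2x³ + 2x⁴)/((1−q)·2κ·κ√(1+s²))`, `x = e^{−κ/4}`, `q = e^{−κ}`, `κ = 2πa`.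
[cite: Drazin2002, §8.3 (8.36)–(8.38)] -/
theorem norm_src_negQuarter_mode0_le (ha : 0 < a) (β s : ℝ)
    (hK : K = fun r : ℝ => (-((Real.exp (-(2 * Real.pi * a * r)) : ℂ) /
            (1 - starRingEnd ℂ (Complex.exp (2 * Real.pi * β * Complex.I)) * (Real.exp (-(2 * Real.pi * a)) : ℂ))
          + (Real.exp (2 * Real.pi * a * (r - 1)) : ℂ) * Complex.exp (2 * Real.pi * β * Complex.I) /
            (1 - Complex.exp (2 * Real.pi * β * Complex.I) * (Real.exp (-(2 * Real.pi * a)) : ℂ))) /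
        (2 * (2 * Real.pi * a) : ℂ)))
    (hG : ∀ u : ℝ, G u = Complex.exp (2 * Real.pi * β * (⌊u⌋ : ℝ) * Complex.I) * K (u - ⌊u⌋)) :
    ‖∫ y in (-(1 / 2 : ℝ))..(1 / 2 : ℝ), G ((-(1 / 4 : ℝ)) - y) * Complex.exp (-((2 * Real.pi * a * s * triWave y : ℝ) : ℂ) * Complex.I)‖ ≤
      (2 + 2 * Real.exp (-(2 * Real.pi * a) / 4) + 4 * Real.exp (-(2 * Real.pi * a) / 4) ^ 2 + 2 * Real.exp (-(2 * Real.pi * a) / 4) ^ 3 +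
          2 * Real.exp (-(2 * Real.pi * a) / 4) ^ 4) /
        (((1 - Real.exp (-(2 * Real.pi * a))) * (2 * (2 * Real.pi * a))) * ((2 * Real.pi * a) * Real.sqrt (1 + s ^ 2))) := by
  have hI : (∫ y in (-(1 / 2 : ℝ))..(1 / 2 : ℝ), G ((-(1 / 4 : ℝ)) - y) * Complex.exp (-((2 * Real.pi * a * s * triWave y : ℝ) : ℂ) * Complex.I)) =
      ∫ y in (-(1 / 2 : ℝ))..(1 / 2 : ℝ), G ((-(1 / 4 : ℝ)) - y) * Complex.exp (((2 * Real.pi * (0 : ℝ) * y : ℝ) : ℂ) * Complex.I) *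
        Complex.exp (-((2 * Real.pi * a * s * triWave y : ℝ) : ℂ) * Complex.I) :=
    intervalIntegral.integral_congr fun y _ => by simp
  rw [hI, src_negQuarter_pieces ha β 0 hK hG s]
  refine (norm_six_le (φ₁ := Real.pi * a) (φ₂ := 0) (φ₃ := -(Real.pi * a)) (s := s)
    (norm_termA_mode0_le ha β (P := 1) (by simp) (Or.inl rfl) (Or.inl rfl) (ν₀ := 2 * Real.pi * 0) (by ring) (-(1 / 4)) (-(1 / 2)) (-(1 / 4)) s (by simp))
    (norm_termB_mode0_le ha β (P := 1) (by simp) (Or.inr rfl) (Or.inl rfl) (ν₀ := 2 * Real.pi * 0) (by ring) (-(1 / 4)) (-(1 / 2)) (-(1 / 4)) s (by simp))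
    (norm_termA_mode0_le ha β (norm_pref_conj β) (Or.inl rfl) (Or.inr rfl) (ν₀ := 2 * Real.pi * 0) (by ring) (3 / 4) (-(1 / 4)) (1 / 4) s (by simp))
    (norm_termB_mode0_le ha β (norm_pref_conj β) (Or.inr rfl) (Or.inr rfl) (ν₀ := 2 * Real.pi * 0) (by ring) (3 / 4) (-(1 / 4)) (1 / 4) s (by simp))
    (norm_termA_mode0_le ha β (norm_pref_conj β) (Or.inl rfl) (Or.inl rfl) (ν₀ := 2 * Real.pi * 0) (by ring) (3 / 4) (1 / 4) (1 / 2) s (by simp))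
    (norm_termB_mode0_le ha β (norm_pref_conj β) (Or.inr rfl) (Or.inl rfl) (ν₀ := 2 * Real.pi * 0) (by ring) (3 / 4) (1 / 4) (1 / 2) s (by simp))).trans
    (le_of_eq ?_)
  set x : ℝ := Real.exp (-(2 * Real.pi * a) / 4) with hx
  have hxj : ∀ (t : ℝ) (j : ℕ), t = -(2 * Real.pi * a) / 4 * j → Real.exp t = x ^ j := by
    intro t j ht; rw [ht, hx, ← Real.exp_nat_mul]; ring_nf
  have p1 : Real.exp (-(2 * Real.pi * a) * -(1 / 4)) * (Real.exp (2 * Real.pi * a * -(1 / 4)) + Real.exp (2 * Real.pi * a * -(1 / 2))) =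
      1 + x := by
    rw [mul_add, ← Real.exp_add, ← Real.exp_add, hxj _ 0 (by push_cast; ring), hxj _ 1 (by push_cast; ring), pow_zero, pow_one]
  have p2 : Real.exp (-(2 * Real.pi * a)) * Real.exp (2 * Real.pi * a * -(1 / 4)) *
      (Real.exp (-(2 * Real.pi * a) * -(1 / 4)) + Real.exp (-(2 * Real.pi * a) * -(1 / 2))) = x ^ 4 + x ^ 3 := by
    rw [mul_add, ← Real.exp_add, ← Real.exp_add, ← Real.exp_add, hxj _ 4 (by push_cast; ring), hxj _ 3 (by push_cast; ring)]
  have p3 : Real.exp (-(2 * Real.pi * a) * (3 / 4)) * (Real.exp (2 * Real.pi * a * (1 / 4)) + Real.exp (2 * Real.pi * a * -(1 / 4))) =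
      x ^ 2 + x ^ 4 := by
    rw [mul_add, ← Real.exp_add, ← Real.exp_add, hxj _ 2 (by push_cast; ring), hxj _ 4 (by push_cast; ring)]
  have p4 : Real.exp (-(2 * Real.pi * a)) * Real.exp (2 * Real.pi * a * (3 / 4)) *
      (Real.exp (-(2 * Real.pi * a) * (1 / 4)) + Real.exp (-(2 * Real.pi * a) * -(1 / 4))) = x ^ 2 + 1 := by
    rw [mul_add, ← Real.exp_add, ← Real.exp_add, ← Real.exp_add, hxj _ 2 (by push_cast; ring), hxj _ 0 (by push_cast; ring), pow_zero]
  have p5 : Real.exp (-(2 * Real.pi * a) * (3 / 4)) * (Real.exp (2 * Real.pi * a * (1 / 2)) + Real.exp (2 * Real.pi * a * (1 / 4))) =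
      x + x ^ 2 := by
    rw [mul_add, ← Real.exp_add, ← Real.exp_add, hxj _ 1 (by push_cast; ring), hxj _ 2 (by push_cast; ring), pow_one]
  have p6 : Real.exp (-(2 * Real.pi * a)) * Real.exp (2 * Real.pi * a * (3 / 4)) *
      (Real.exp (-(2 * Real.pi * a) * (1 / 2)) + Real.exp (-(2 * Real.pi * a) * (1 / 4))) = x ^ 3 + x ^ 2 := by
    rw [mul_add, ← Real.exp_add, ← Real.exp_add, ← Real.exp_add, hxj _ 3 (by push_cast; ring), hxj _ 2 (by push_cast; ring)]
  rw [p1, p2, p3, p4, p5, p6]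
  ring

end envelope

end Summit.AnomalousDissipation.AnomalousDissipation.Theorems.SawtoothPulseCascade.K2PhaseBudget

end
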